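import Summits.ResolutionOfSingularities.ResolutionOfSingularities.Theorems.ValuativeLuAlphaPTorsorAdaptedValueStepExpansion
import HarnessLib

/-!
# Adapted value step, V: the cut of a level

Crux `Valuative.LuAlphaPTorsor` (stmt-ResolutionOfSingularities-0641), line `pfaff-line-log-final-forms`,
registered stub `stub_adaptedValueStep` (F6v, wave 2: the ADAPTED value step of the purely
inseparable tower, any rank) — helper file 5/8.

Fix a level `ℓ` of the new parameters `y` (`xᵢ = y^(cᵢ) wᵢ`). `adValue_level_cut`: the old
parameters whose exponent vectors touch the levels `≥ ℓ` are exactly the old parameters of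
level `≥ ℓ₁` for a cut `ℓ₁`; `adValue_smallY_iff_mem`: for `r ∈ R`, being smaller than every
`y`-monomial of the levels `< ℓ` is membership in the level-`ℓ₁` ideal of `R` ((C3) of the
input); `adValue_no_defect`: an `x`-Laurent monomial whose value is a `y`-monomial of the levels
`< ℓ` only involves old parameters of level `< ℓ₁` ((C4) and `LevelArchimedean` of the input:
the flags of convex subgroups of the two value lattices correspond). [folklore]
-/

noncomputable section

-- `Summit.<S>.<S>.…` duplicates the summit name by design (D-0017, single-problem summit).
set_option linter.dupNamespace false

open IsLocalRing

namespace Summit.ResolutionOfSingularities.ResolutionOfSingularities.Theorems.PfaffLine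

open Literature.AlgebraicGeometry.Resolution

section LevelD

variable {k K : Type} [Field k] [Field K] [Algebra k K] (O : ValuationSubring K) {n : ℕ}
  (R : Subalgebra k K) (hRO : R.toSubring ≤ O.toSubring) (x : Fin n → K) (hx : ∀ i, x i ∈ R)
  (lv : Fin n → ℕ)
  (hx0 : ∀ i, x i ≠ 0)
  (hind : ∀ m : Fin n → ℤ, (∏ i, O.valuation (x i) ^ (m i)) = 1 → m = 0)
  (hC2a : ∀ i i', lv i < lv i' → ∀ m : Fin n → ℤ, (∀ j, lv i < lv j → m j = 0) →
    O.valuation (x i') < ∏ j, O.valuation (x j) ^ (m j))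
  (hC4 : ∀ (ℓ : ℕ) (μ : Fin n → ℤ), (∀ j, lv j ≠ ℓ → μ j = 0) → μ ≠ 0 →
    (∀ m : Fin n → ℤ, (∀ j, ℓ ≤ lv j → m j = 0) →
      (∏ j, O.valuation (x j) ^ (μ j)) < ∏ j, O.valuation (x j) ^ (m j)) ∨
    (∀ m : Fin n → ℤ, (∀ j, ℓ ≤ lv j → m j = 0) →
      (∏ j, O.valuation (x j) ^ (m j)) < ∏ j, O.valuation (x j) ^ (μ j)))
  (hLA : LevelArchimedean (fun i => O.valuation (x i)) lv)
  (hC3 : ∀ (ℓ : ℕ) (z : R.toSubring),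
    z ∈ Ideal.span (Set.range fun i : {i : Fin n // ℓ ≤ lv i} => (⟨x i.1, hx i.1⟩ : R.toSubring)) ↔
      ∀ m : Fin n → ℤ, (∀ j, ℓ ≤ lv j → m j = 0) →
        O.valuation (z : K) < ∏ j, O.valuation (x j) ^ (m j))
  (y : Fin n → K) (lv' : Fin n → ℕ) (hy0 : ∀ j, y j ≠ 0) (hvy1 : ∀ j, O.valuation (y j) < 1)
  (hC2a' : ∀ i i', lv' i < lv' i' → ∀ m : Fin n → ℤ, (∀ j, lv' i < lv' j → m j = 0) →
    O.valuation (y i') < ∏ j, O.valuation (y j) ^ (m j))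
  (c : Fin n → Fin n → ℕ) (w : Fin n → K) (hw : ∀ i, w i ∈ R) (hwi : ∀ i, (w i)⁻¹ ∈ R)
  (hxw : ∀ i, x i = (∏ j, y j ^ (c i j)) * w i)
  (ℓ : ℕ)

include hRO hx0 hw hwi hxw in
/-- The units `wᵢ` of `xᵢ = y^{cᵢ} wᵢ` have value `1`. -/
theorem adValue_vw (i : Fin n) : O.valuation (w i) = 1 := by
  have hw0 : w i ≠ 0 := fun h => hx0 i (by rw [hxw i, h, mul_zero])
  refine le_antisymm ((O.valuation_le_one_iff _).mpr (hRO (hw i))) ?_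
  have h2 := (O.valuation_le_one_iff _).mpr (hRO (hwi i))
  rw [map_inv₀, inv_le_one₀ ((Valuation.pos_iff _).mpr hw0)] at h2
  exact h2

include hRO hx0 hw hwi hxw in
/-- `v(xᵢ) = v(y)^{cᵢ}`. -/
theorem adValue_vx (i : Fin n) : O.valuation (x i) = ∏ j, O.valuation (y j) ^ (c i j) := by
  rw [hxw i, map_mul, adValue_vw O R hRO x hx0 y c w hw hwi hxw i, mul_one, valuation_prod_pow]

include hRO hx0 hy0 hw hwi hxw in
/-- Laurent monomials in `x` are Laurent monomials in `y`: `v(x^m) = v(y)^{∑ mᵢ cᵢ}`. -/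
theorem adValue_vxmono (m : Fin n → ℤ) :
    (∏ i, O.valuation (x i) ^ (m i)) =
      ∏ j, O.valuation (y j) ^ ((∑ i, m i • fun j => (c i j : ℤ)) j) := by
  have hvy0 : ∀ j, O.valuation (y j) ≠ 0 := fun j => (map_ne_zero _).mpr (hy0 j)
  rw [adValue_prod_zpow_finsum _ hvy0]
  refine Finset.prod_congr rfl fun i _ => ?_
  rw [prod_zpow_smul_eq]
  congr 1
  exact (adValue_vx O R hRO x hx0 y c w hw hwi hxw i).trans
    (Finset.prod_congr rfl fun j _ => (zpow_natCast _ _).symm)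

include hvy1 hC2a' in
/-- A parameter `y_h` of level `≥ ℓ` is smaller than every Laurent monomial of levels `< ℓ`. -/
theorem adValue_yhigh_small (h : Fin n) (hh : ℓ ≤ lv' h) :
    ∀ m : Fin n → ℤ, (∀ j, ℓ ≤ lv' j → m j = 0) →
      O.valuation (y h) < ∏ j, O.valuation (y j) ^ (m j) :=
  adValue_high_lt_low (fun j => O.valuation (y j)) lv' hC2a' hvy1 ℓ h hh

include hRO hx0 hvy1 hC2a' hw hwi hxw in
/-- An old parameter `xᵢ` whose exponent vector `cᵢ` touches the levels `≥ ℓ` of `y` is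
smaller than every Laurent monomial of the levels `< ℓ`. -/
theorem adValue_xS_small (i : Fin n) (hi : ∃ h, ℓ ≤ lv' h ∧ c i h ≠ 0) :
    ∀ m : Fin n → ℤ, (∀ j, ℓ ≤ lv' j → m j = 0) →
      O.valuation (x i) < ∏ j, O.valuation (y j) ^ (m j) := by
  obtain ⟨h, hh, hch⟩ := hi
  intro m hm
  calc O.valuation (x i) = ∏ j, O.valuation (y j) ^ (c i j) :=
        adValue_vx O R hRO x hx0 y c w hw hwi hxw i
    _ ≤ O.valuation (y h) :=
        adValue_prod_pow_le_single (fun j => O.valuation (y j)) (fun j => (hvy1 j).le) (c i) hch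
    _ < ∏ j, O.valuation (y j) ^ (m j) := adValue_yhigh_small O y lv' hvy1 hC2a' ℓ h hh m hm

include hRO hx0 hC2a hLA hC3 hy0 hvy1 hC2a' hw hwi hxw in
/-- **The level cut.** The old parameters whose exponent vectors touch the levels `≥ ℓ` of the
new ones are exactly the old parameters of level `≥ ℓ₁`, for some `ℓ₁` (attained if relevant). -/
theorem adValue_level_cut : ∃ ℓ₁ : ℕ, (∀ i, (∃ h, ℓ ≤ lv' h ∧ c i h ≠ 0) ↔ ℓ₁ ≤ lv i) ∧
    (∀ i, ℓ₁ ≤ lv i → ∃ i₀, lv i₀ = ℓ₁) := by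
  classical
  have hvy0 : ∀ j, O.valuation (y j) ≠ 0 := fun j => (map_ne_zero _).mpr (hy0 j)
  set Sset := Finset.univ.filter fun i => ∃ h, ℓ ≤ lv' h ∧ c i h ≠ 0 with hSset
  rcases Sset.eq_empty_or_nonempty with hS0 | hSne
  · -- no old parameter is small: cut above all levels
    refine ⟨(Finset.univ.sup lv) + 1, fun i => ⟨fun hi => ?_, fun hi => ?_⟩, fun i hi => ?_⟩
    · have : i ∈ Sset := Finset.mem_filter.mpr ⟨Finset.mem_univ _, hi⟩
      rw [hS0] at this
      exact absurd this (Finset.notMem_empty _)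
    · exact absurd (Finset.le_sup (f := lv) (Finset.mem_univ i)) (by omega)
    · exact absurd (Finset.le_sup (f := lv) (Finset.mem_univ i)) (by omega)
  -- the cut is the least level of a small old parameter
  obtain ⟨i₀, hi₀S, hmin⟩ := Finset.exists_min_image Sset lv hSne
  have hi₀ : ∃ h, ℓ ≤ lv' h ∧ c i₀ h ≠ 0 := (Finset.mem_filter.mp hi₀S).2
  have hsmall₀ := adValue_xS_small O R hRO x hx0 y lv' hvy1 hC2a' c w hw hwi hxw ℓ i₀ hi₀
  have hlt1 := adValue_param_lt_one O R x hx lv hC3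
  refine ⟨lv i₀, fun i => ⟨fun hi => hmin i (Finset.mem_filter.mpr ⟨Finset.mem_univ _, hi⟩),
    fun hi => ?_⟩, fun _ _ => ⟨i₀, rfl⟩⟩
  by_contra hnot
  push Not at hnot
  -- `v(x i) = v(y)^{c i}` is a monomial of the levels `< ℓ`
  have hci : ∀ j, ℓ ≤ lv' j → (fun j => (c i j : ℤ)) j = 0 := fun j hj => by
    simp only [hnot j hj, Nat.cast_zero]
  have hvxi : O.valuation (x i) = ∏ j, O.valuation (y j) ^ ((fun j => (c i j : ℤ)) j) := by
    rw [adValue_vx O R hRO x hx0 y c w hw hwi hxw i]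
    exact Finset.prod_congr rfl fun j _ => (zpow_natCast _ _).symm
  rcases hi.lt_or_eq with hlt | heq
  · -- `lv i₀ < lv i`: `x i < x i₀ < y^{c i} = x i`
    have h1 : O.valuation (x i) < O.valuation (x i₀) := by
      have := hC2a i₀ i hlt (Pi.single i₀ 1) fun j hj => by
        rw [Pi.single_eq_of_ne (fun h => (lt_irrefl (lv j)) (by rw [h] at hj ⊢; exact hj))]
      rwa [Finset.prod_eq_single i₀ (fun j _ hj => by rw [Pi.single_eq_of_ne hj, zpow_zero])
        (fun h => absurd (Finset.mem_univ i₀) h), Pi.single_eq_same, zpow_one] at this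
    have h2 := hsmall₀ _ hci
    rw [← hvxi] at h2
    exact lt_asymm h1 h2
  · -- `lv i₀ = lv i`: lattice-archimedean comparison at that level
    have hsingle : ∀ i', (∏ j, O.valuation (x j) ^ ((Pi.single i' 1 : Fin n → ℤ) j)) =
        O.valuation (x i') := fun i' => by
      rw [Finset.prod_eq_single i' (fun j _ hj => by rw [Pi.single_eq_of_ne hj, zpow_zero])
        (fun h => absurd (Finset.mem_univ i') h), Pi.single_eq_same, zpow_one]
    obtain ⟨N, hN⟩ := hLA (lv i) (Pi.single i 1) (Pi.single i₀ 1)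
      (fun j hj => by rw [Pi.single_eq_of_ne (fun h => hj (by rw [h]))])
      (fun j hj => by rw [Pi.single_eq_of_ne (fun h => hj (by rw [h, heq]))])
      (fun m hm => by
        rw [hsingle]
        exact adValue_lt_lower (fun j => O.valuation (x j)) lv hC2a hlt1 i m hm)
    rw [hsingle, hsingle] at hN
    have h2 := hsmall₀ ((N : ℤ) • fun j => (c i j : ℤ)) fun j hj => by
      simp only [Pi.smul_apply, smul_eq_mul, hnot j hj, Nat.cast_zero, mul_zero]
    rw [prod_zpow_smul_eq, ← hvxi, zpow_natCast] at h2
    exact lt_asymm hN h2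

include hRO hx0 hC3 hy0 hvy1 hC2a' hw hwi hxw in
/-- **Smallness of old elements.** For `r ∈ R`, being smaller than every Laurent monomial of
the levels `< ℓ` of `y` is membership in the ideal of the old parameters of level `≥ ℓ₁`. -/
theorem adValue_smallY_iff_mem (ℓ₁ : ℕ) (hℓ₁ : ∀ i, (∃ h, ℓ ≤ lv' h ∧ c i h ≠ 0) ↔ ℓ₁ ≤ lv i)
    {r : K} (hr : r ∈ R) :
    (∀ m : Fin n → ℤ, (∀ j, ℓ ≤ lv' j → m j = 0) →
      O.valuation r < ∏ j, O.valuation (y j) ^ (m j)) ↔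
    (⟨r, hr⟩ : R.toSubring) ∈ Ideal.span (Set.range
        fun i : {i : Fin n // ℓ₁ ≤ lv i} => (⟨x i.1, hx i.1⟩ : R.toSubring)) := by
  classical
  have hvy0' : ∀ m : Fin n → ℤ, (∏ j, O.valuation (y j) ^ (m j)) ≠ 0 := fun m =>
    Finset.prod_ne_zero_iff.mpr fun j _ => zpow_ne_zero _ ((map_ne_zero _).mpr (hy0 j))
  constructor
  · intro hsmall
    refine (hC3 ℓ₁ ⟨r, hr⟩).mpr fun m hm => ?_
    rw [adValue_vxmono O R hRO x hx0 y hy0 c w hw hwi hxw m]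
    refine hsmall _ fun j hj => ?_
    simp only [Finset.sum_apply, Pi.smul_apply, smul_eq_mul]
    refine Finset.sum_eq_zero fun i _ => ?_
    by_cases hi : ℓ₁ ≤ lv i
    · rw [hm i hi, zero_mul]
    · have hci : c i j = 0 := by
        by_contra hc
        exact hi ((hℓ₁ i).mp ⟨j, hj, hc⟩)
      rw [hci, Nat.cast_zero, mul_zero]
  · intro hmem
    obtain ⟨d, hdR, hd0, hrd⟩ := (adValue_mem_levelIdeal_iff R x hx lv ℓ₁ hr).mp hmem
    rw [hrd]
    refine adValue_small_sum O y lv' hy0 _ _ ℓ fun i _ m hm => ?_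
    by_cases hi : ℓ₁ ≤ lv i
    · exact adValue_small_mul O y lv' ((O.valuation_le_one_iff _).mpr (hRO (hdR i))) ℓ
        (adValue_xS_small O R hRO x hx0 y lv' hvy1 hC2a' c w hw hwi hxw ℓ i
          ((hℓ₁ i).mpr hi)) m hm
    · rw [hd0 i (not_le.mp hi), mul_zero, map_zero]
      exact zero_lt_iff.mpr (hvy0' m)

include hRO hx0 hC4 hLA hC3 hy0 hvy1 hC2a' hw hwi hxw in
/-- **No defect.** A Laurent monomial in the old parameters whose value is a Laurent monomial in
the new parameters of the levels `< ℓ` involves only old parameters of level `< ℓ₁`. -/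
theorem adValue_no_defect (ℓ₁ : ℕ) (hℓ₁ : ∀ i, (∃ h, ℓ ≤ lv' h ∧ c i h ≠ 0) ↔ ℓ₁ ≤ lv i)
    (hℓ₁' : ∀ i, ℓ₁ ≤ lv i → ∃ i₀, lv i₀ = ℓ₁) (m : Fin n → ℤ)
    (hm : ∃ μ : Fin n → ℤ, (∀ j, ℓ ≤ lv' j → μ j = 0) ∧
      (∏ i, O.valuation (x i) ^ (m i)) = ∏ j, O.valuation (y j) ^ (μ j)) :
    ∀ i, ℓ₁ ≤ lv i → m i = 0 := by
  classical
  have hvx0 : ∀ i, O.valuation (x i) ≠ 0 := fun i => (map_ne_zero _).mpr (hx0 i)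
  have hvy0 : ∀ j, O.valuation (y j) ≠ 0 := fun j => (map_ne_zero _).mpr (hy0 j)
  have hlt1 := adValue_param_lt_one O R x hx lv hC3
  obtain ⟨μ, hμ, hmμ⟩ := hm
  by_contra hex
  push Not at hex
  -- the high part `mS` of `m` and its top level `B`
  set mS : Fin n → ℤ := fun i => if ℓ₁ ≤ lv i then m i else 0 with hmS
  set mL : Fin n → ℤ := fun i => if ℓ₁ ≤ lv i then 0 else m i with hmL
  have hmsplit : m = mS + mL := funext fun i => by
    by_cases hi : ℓ₁ ≤ lv i <;> simp [mS, mL, hi]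
  -- `x^{mL}` is a low `y`-monomial, hence so is `x^{mS}`
  obtain ⟨μS, hμS, hmSμ⟩ : ∃ μS : Fin n → ℤ, (∀ j, ℓ ≤ lv' j → μS j = 0) ∧
      (∏ i, O.valuation (x i) ^ (mS i)) = ∏ j, O.valuation (y j) ^ (μS j) := by
    refine ⟨μ - ∑ i, mL i • fun j => (c i j : ℤ), fun j hj => ?_, ?_⟩
    · rw [Pi.sub_apply, hμ j hj, zero_sub, neg_eq_zero]
      simp only [Finset.sum_apply, Pi.smul_apply, smul_eq_mul]
      refine Finset.sum_eq_zero fun i _ => ?_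
      by_cases hi : ℓ₁ ≤ lv i
      · simp [mL, hi]
      · have hci : c i j = 0 := by
          by_contra hc
          exact hi ((hℓ₁ i).mp ⟨j, hj, hc⟩)
        rw [hci, Nat.cast_zero, mul_zero]
    · rw [adValue_prod_zpow_sub _ hvy0, ← hmμ,
        ← adValue_vxmono O R hRO x hx0 y hy0 c w hw hwi hxw mL, hmsplit,
        prod_zpow_add_eq _ hvx0, mul_inv_cancel_right₀ (adValue_prod_zpow_ne_zero _ hvx0 mL)]
  have hmS0 : ∃ i, mS i ≠ 0 := by
    obtain ⟨i, hi, hmi⟩ := hex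
    refine ⟨i, ?_⟩
    simp only [hmS, if_pos hi]
    exact hmi
  obtain ⟨iB, hiB, hBmax⟩ := Finset.exists_max_image (Finset.univ.filter fun i => mS i ≠ 0) lv
    (by obtain ⟨i, hi⟩ := hmS0; exact ⟨i, Finset.mem_filter.mpr ⟨Finset.mem_univ _, hi⟩⟩)
  have hiB' : mS iB ≠ 0 := (Finset.mem_filter.mp hiB).2
  have hBℓ₁ : ℓ₁ ≤ lv iB := by
    by_contra h
    exact hiB' (by simp only [hmS, if_neg h])
  -- split `mS = m₀ + m''` along the top level `B`
  set B : ℕ := lv iB with hB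
  set m₀ : Fin n → ℤ := fun i => if lv i = B then mS i else 0 with hm₀
  set m'' : Fin n → ℤ := fun i => if lv i = B then 0 else mS i with hm''
  have hsplit : mS = m₀ + m'' := funext fun i => by
    by_cases hi : lv i = B
    · simp only [hm₀, hm'', Pi.add_apply, if_pos hi, add_zero]
    · simp only [hm₀, hm'', Pi.add_apply, if_neg hi, zero_add]
  have hm₀supp : ∀ j, lv j ≠ B → m₀ j = 0 := fun j hj => by simp only [hm₀, if_neg hj]
  have hiBB : lv iB = B := hB.symm
  have hm₀ne : m₀ ≠ 0 := fun h => hiB' (by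
    have := congrFun h iB
    simp only [hm₀, if_pos hiBB, Pi.zero_apply] at this
    exact this)
  have hm''supp : ∀ j, m'' j ≠ 0 → ℓ₁ ≤ lv j ∧ lv j < B := fun j hj => by
    have hjB : lv j ≠ B := fun h => hj (by simp only [hm'', if_pos h])
    have hmSj : mS j ≠ 0 := fun h => hj (by simp only [hm'', h, ite_self])
    refine ⟨?_, lt_of_le_of_ne (hB ▸ hBmax j (Finset.mem_filter.mpr ⟨Finset.mem_univ _, hmSj⟩)) hjB⟩
    by_contra h
    exact hmSj (by simp only [hmS, if_neg h])
  -- the small old parameter used for the comparison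
  have hsingle : ∀ i', (∏ j, O.valuation (x j) ^ ((Pi.single i' 1 : Fin n → ℤ) j)) =
      O.valuation (x i') := fun i' => by
    rw [Finset.prod_eq_single i' (fun j _ hj => by rw [Pi.single_eq_of_ne hj, zpow_zero])
      (fun h => absurd (Finset.mem_univ i') h), Pi.single_eq_same, zpow_one]
  have hpos := adValue_prod_zpow_pos (fun j => O.valuation (y j)) hvy0
  rcases hBℓ₁.lt_or_eq with hlt | heq
  · -- `ℓ₁ < B`: compare with an old parameter of level `ℓ₁`
    obtain ⟨i₀, hi₀⟩ := hℓ₁' iB hBℓ₁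
    have hsm₀ := adValue_xS_small O R hRO x hx0 y lv' hvy1 hC2a' c w hw hwi hxw ℓ i₀
      ((hℓ₁ i₀).mpr hi₀.ge)
    -- the lower test monomials `k e_{i₀} - m''`
    have htest : ∀ kk : ℤ, ∀ j, B ≤ lv j → (kk • (Pi.single i₀ 1 : Fin n → ℤ) - m'') j = 0 := by
      intro kk j hj
      rw [Pi.sub_apply, Pi.smul_apply, smul_eq_mul, Pi.single_eq_of_ne (fun h => by
        rw [h, hi₀] at hj; exact absurd hj (not_le.mpr hlt)), mul_zero, zero_sub, neg_eq_zero]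
      by_contra hmj
      exact absurd (hm''supp j hmj).2 (not_lt.mpr hj)
    have hXtest : ∀ kk : ℤ, (∏ j, O.valuation (x j) ^ ((kk • (Pi.single i₀ 1 : Fin n → ℤ) - m'') j)) =
        O.valuation (x i₀) ^ kk * (∏ j, O.valuation (x j) ^ (m'' j))⁻¹ := fun kk => by
      rw [adValue_prod_zpow_sub _ hvx0, prod_zpow_smul_eq, hsingle]
    have hXmS : (∏ j, O.valuation (x j) ^ (mS j)) =
        (∏ j, O.valuation (x j) ^ (m₀ j)) * ∏ j, O.valuation (x j) ^ (m'' j) := by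
      rw [hsplit, prod_zpow_add_eq _ hvx0]
    have hm''0 := adValue_prod_zpow_ne_zero (fun j => O.valuation (x j)) hvx0 m''
    rcases hC4 B m₀ hm₀supp hm₀ne with hA | hBcase
    · have h1 := hA _ (htest 1)
      rw [hXtest, zpow_one, lt_mul_inv_iff₀ (zero_lt_iff.mpr hm''0), ← hXmS, hmSμ] at h1
      exact lt_asymm h1 (hsm₀ μS hμS)
    · have h1 := hBcase _ (htest (-1))
      rw [hXtest, mul_inv_lt_iff₀ (zero_lt_iff.mpr hm''0), ← hXmS, hmSμ, zpow_neg, zpow_one,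
        inv_lt_comm₀ ((Valuation.pos_iff _).mpr (hx0 i₀)) (hpos μS), ← prod_zpow_neg_eq] at h1
      exact lt_asymm h1 (hsm₀ (-μS) fun j hj => by rw [Pi.neg_apply, hμS j hj, neg_zero])
  · -- `B = ℓ₁`: `m'' = 0`, lattice-archimedean comparison with `x_{iB}`
    have hm''0 : m'' = 0 := by
      funext j
      by_contra hj
      have := hm''supp j hj
      omega
    have hmSm₀ : mS = m₀ := by rw [hsplit, hm''0, add_zero]
    have hsmB := adValue_xS_small O R hRO x hx0 y lv' hvy1 hC2a' c w hw hwi hxw ℓ iB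
      ((hℓ₁ iB).mpr hBℓ₁)
    rcases hC4 B m₀ hm₀supp hm₀ne with hA | hBcase
    · obtain ⟨N, hN⟩ := hLA B m₀ (Pi.single iB 1) hm₀supp
        (fun j hj => by rw [Pi.single_eq_of_ne (fun h => hj (by rw [h]))]) hA
      rw [hsingle, ← hmSm₀, hmSμ, ← zpow_natCast, ← prod_zpow_smul_eq] at hN
      exact lt_asymm hN (hsmB _ fun j hj => by
        rw [Pi.smul_apply, smul_eq_mul, hμS j hj, mul_zero])
    · have hA' : ∀ mm : Fin n → ℤ, (∀ j, B ≤ lv j → mm j = 0) →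
          (∏ j, O.valuation (x j) ^ ((-m₀) j)) < ∏ j, O.valuation (x j) ^ (mm j) := by
        intro mm hmm
        have h := hBcase (-mm) fun j hj => by rw [Pi.neg_apply, hmm j hj, neg_zero]
        rw [prod_zpow_neg_eq] at h
        rw [prod_zpow_neg_eq]
        exact (inv_lt_comm₀ (adValue_prod_zpow_pos _ hvx0 mm) (adValue_prod_zpow_pos _ hvx0 m₀)).mp h
      obtain ⟨N, hN⟩ := hLA B (-m₀) (Pi.single iB 1)
        (fun j hj => by rw [Pi.neg_apply, hm₀supp j hj, neg_zero])
        (fun j hj => by rw [Pi.single_eq_of_ne (fun h => hj (by rw [h]))]) hA'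
      rw [hsingle, prod_zpow_neg_eq, ← hmSm₀, hmSμ, ← prod_zpow_neg_eq, ← zpow_natCast,
        ← prod_zpow_smul_eq] at hN
      exact lt_asymm hN (hsmB _ fun j hj => by
        rw [Pi.smul_apply, Pi.neg_apply, smul_eq_mul, hμS j hj, neg_zero, mul_zero])

end LevelD

/-- Registered anchor of this helper file: a unit of `R ⊆ O` has value `1`. -/
theorem adValue_anchor_level : ∀ (k K : Type) [Field k] [Field K] [Algebra k K] (O : ValuationSubring K) (R : Subalgebra k K), R.toSubring ≤ O.toSubring → ∀ (w : K), w ∈ R → w⁻¹ ∈ R → w ≠ 0 → O.valuation w = 1 := by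
  intro k K _ _ _ O R hRO w hw hwi hw0
  refine le_antisymm ((O.valuation_le_one_iff _).mpr (hRO hw)) ?_
  have h2 := (O.valuation_le_one_iff _).mpr (hRO hwi)
  rw [map_inv₀, inv_le_one₀ ((Valuation.pos_iff _).mpr hw0)] at h2
  exact h2

end Summit.ResolutionOfSingularities.ResolutionOfSingularities.Theorems.PfaffLine

end
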